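import Mathlib
import Summits.ValiantsHypothesis.ValiantsHypothesis.Theorems.SymPencilSymmetrizePermPairsPermEmbeddingDSubPrelim
import HarnessLib

/-!
# ValiantsHypothesis / SymPencil — crux `SymmetrizePermPairs` (stmt-ValiantsHypothesis-17793),
# stub `stub_induce`, ASSEMBLY [A1]: the irreducible permutation embedding (D) for a lift group
# over a SUBGROUP `H ≤ 𝔖_n × 𝔖_n`, from the group step (GS) and the two-degree bounds (H1)₂, (H2)₂

The closed sister crux `EquivariantSdcNotQP` permified a `Γ_n`-equivariant pencil through
(D) = «every irreducible `ρ : G → GL_k(ℂ)` of a finite `G ↠ 𝔖_n × 𝔖_n`, scalar (`μ_M`) on the kernel,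
is an equivariant retract of a permutation representation of size `2^{(log₂ M + log₂ n + d)^d}`»
(`permEmbeddingD_of_alternatingBounds : (H1) → (H2) → (D)`).  For `stub_induce` the group `G` only
maps to `𝔖_n × 𝔖_n` with image `H` of index `R`, and the budget may be quasi-polynomial in `R` too.
This file proves the subgroup form

  (D)_H: for every finite `G`, `φ : G → 𝔖_n × 𝔖_n` (no surjectivity), `ρ : G → GL_k(ℂ)` irreducible
  and scalar with `M`-th roots of unity on `ker φ`, `k ≤ M`: an equivariant retract (`p ι = 1`,
  `P_τ ι = ι ρ`, `p P_τ = ρ p`) of size `m' ≤ 2^{(log₂ M + log₂ n + log₂ [𝔖_n² : φ(G)] + d)^d}`,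

from three inputs taken as hypotheses VERBATIM: (GS) the group step «a subgroup of `𝔖_n × 𝔖_n` of
index `< C(n,k₀)` and `< (n−k₀)!/2` contains `Alt(Ω∖X₁) × Alt(Ω∖X₂)`, `|X_i| < k₀`» (landed pieces:
`SmallIndex.le_goursatFst_of_index_lt_card` + Dixon–Mortimer 5.2B; assembled by the (C1) seat),
(H1)₂ the two-degree spin dichotomy (piece (K3)) and (H2)₂ the two-degree Young fixed vectors
(piece (K4), landed as `YoungBounds.youngFixedVector_two_holds`).

Regimes of the proof (`permEmbeddingD_sub_of_bounds`): (A) `n ≤ a'(log₂ k + 1)` or (B)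
`n ≤ 4 log₂ R + 12` — Frobenius retract through `ker ρ`, `[G : ker ρ] ≤ (n!)² M`
(`index_ker_le_card_mul`, `budget_large`); (C) otherwise `k₀ = log₂ R + 1` satisfies the small-index
numerics, (GS) gives `E = φ⁻¹(Alt(Ω∖X₁) × Alt(Ω∖X₂))` of index `≤ 4 n^{2k₀}` with
`ψ : E ↠ 𝔄_a × 𝔄_b` (`Equiv.altCongrHom`), and the 17792 argument runs on `E`: (H1)₂ either returns to
(A) or de-twists by `θ` (`[E : ker θ] ≤ M`, perfectness of `𝔄_a × 𝔄_b`, `a, b ≥ 5`), (H2)₂ gives the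
Young subgroup and the fixed functional, `permRetract_frobenius` the retract (`budget_main`).

Honest framing: conditional assembly ((GS), (H1)₂ hypotheses; (H2)₂ landed) for an OPEN stub of an
OPEN crux; the symmetric-output core (C3) is untouched; `VP ≠ VNP` is NOT proved and nothing here is
progress on it.  No new definitions, no named facts (`--supports stmt-ValiantsHypothesis-17793 --as helper`).
-/

noncomputable section

-- `Summit.ValiantsHypothesis.ValiantsHypothesis.…` is the tree's mandated single-conjunct layout
-- (Sub = Summit), so the duplicated namespace component is intended.
set_option linter.dupNamespace false

namespace Summit.ValiantsHypothesis.ValiantsHypothesis.Theorems.SymPencilEquivariantSdcNotQP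

open Matrix Equiv Equiv.Perm


open PermEmbeddingSub YoungBounds

/-! ### [A1] (D)_H from (GS), (H1)₂, (H2)₂ -/

/-- **(D)_H ⇐ (GS) ∧ (H1)₂ ∧ (H2)₂.**  See the module docstring: the irreducible permutation
embedding for a finite group `G` mapping (not necessarily onto) to `𝔖_n × 𝔖_n`, with budget
quasi-polynomial in `M`, `n` and the index `R` of the image, from the group step (GS), the
two-degree spin dichotomy (H1)₂ and the two-degree Young fixed vectors (H2)₂ (all verbatim
hypotheses; (H2)₂ is the landed `YoungBounds.youngFixedVector_two_holds`).  Conditional assembly;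
`stub_induce`, the crux `SymmetrizePermPairs` and `VP ≠ VNP` remain OPEN. [folklore] -/
theorem permEmbeddingD_sub_of_bounds
    (hGS : ∀ (n : ℕ) (I : Subgroup (Perm (Fin n) × Perm (Fin n))) (k₀ : ℕ),
      8 < n → 1 ≤ k₀ → 4 * k₀ ≤ n → I.index < n.choose k₀ → 2 * I.index < (n - k₀).factorial →
      ∃ X₁ X₂ : Finset (Fin n), X₁.card < k₀ ∧ X₂.card < k₀ ∧
        ((alternatingGroup {x // x ∉ X₁}).map
            (Equiv.Perm.ofSubtype : Perm {x // x ∉ X₁} →* Perm (Fin n))).prod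
          ((alternatingGroup {x // x ∉ X₂}).map
            (Equiv.Perm.ofSubtype : Perm {x // x ∉ X₂} →* Perm (Fin n))) ≤ I)
    (hExt : ∃ a₀ : ℕ, ∀ (a b k : ℕ) (E : Type) [Group E] [Finite E]
      (ψ : E →* ↥(alternatingGroup (Fin a)) × ↥(alternatingGroup (Fin b)))
      (σ : E →* GL (Fin k) ℂ),
      Function.Surjective ψ →
      (∀ g : E, ψ g = 1 → ∃ c : ℂ,
        (σ g : Matrix (Fin k) (Fin k) ℂ) = c • (1 : Matrix (Fin k) (Fin k) ℂ)) →
      min a b ≤ a₀ * (Nat.log 2 k + 1) ∨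
        ∃ θ : E →* ℂˣ, ∀ g : E, ψ g = 1 →
          (σ g : Matrix (Fin k) (Fin k) ℂ) = ((θ g : ℂˣ) : ℂ) • (1 : Matrix (Fin k) (Fin k) ℂ))
    (hYoung : ∃ c : ℕ, ∀ (a b k : ℕ)
      (σ : ↥(alternatingGroup (Fin a)) × ↥(alternatingGroup (Fin b)) →* GL (Fin k) ℂ), 1 ≤ k →
      ∃ Y : Subgroup (↥(alternatingGroup (Fin a)) × ↥(alternatingGroup (Fin b))),
        Y.index ≤ 2 ^ ((Nat.log 2 k + Nat.log 2 (max a b) + c) ^ c) ∧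
        ∃ ℓ : (Fin k → ℂ) →ₗ[ℂ] ℂ, ℓ ≠ 0 ∧
          ∀ y ∈ Y, ℓ ∘ₗ Matrix.toLin' (σ y : Matrix (Fin k) (Fin k) ℂ) = ℓ) :
    ∃ d : ℕ, ∀ (n M k : ℕ) (G : Type) [Group G] [Finite G]
      (φ : G →* Perm (Fin n) × Perm (Fin n)) (ρ : G →* GL (Fin k) ℂ),
      (∀ g : G, φ g = 1 → ∃ c : ℂ, c ^ M = 1 ∧
        (ρ g : Matrix (Fin k) (Fin k) ℂ) = c • (1 : Matrix (Fin k) (Fin k) ℂ)) →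
      k ≤ M →
      (∀ W : Submodule ℂ (Fin k → ℂ),
        (∀ g : G, W ≤ W.comap (Matrix.toLin' (ρ g : Matrix (Fin k) (Fin k) ℂ))) → W = ⊥ ∨ W = ⊤) →
      ∃ m' ≤ 2 ^ ((Nat.log 2 M + Nat.log 2 n + Nat.log 2 φ.range.index + d) ^ d),
        ∃ (ι : Matrix (Fin m') (Fin k) ℂ) (p : Matrix (Fin k) (Fin m') ℂ) (τ : G → Perm (Fin m')),
          p * ι = 1 ∧ ∀ g : G,
            (τ g).permMatrix ℂ * ι = ι * (ρ g : Matrix (Fin k) (Fin k) ℂ) ∧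
            p * (τ g).permMatrix ℂ = (ρ g : Matrix (Fin k) (Fin k) ℂ) * p := by
  classical
  obtain ⟨a₀, ha⟩ := hExt
  obtain ⟨c, hc⟩ := hYoung
  obtain ⟨a', ha'1, ha'2⟩ : ∃ a' : ℕ, 2 * a₀ ≤ a' ∧ 4 ≤ a' :=
    ⟨max (2 * a₀) 4, le_max_left _ _, le_max_right _ _⟩
  obtain ⟨d, hd1, hd2, hd3⟩ : ∃ d : ℕ, 2 * a' + 3 ≤ d ∧ 27 ≤ d ∧ c + 4 ≤ d :=
    ⟨2 * a' + 3 + 27 + (c + 4), by omega, by omega, by omega⟩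
  refine ⟨d, fun n M k G _ _ φ ρ hker hkM hirr => ?_⟩
  set R : ℕ := φ.range.index with hR
  set Bd : ℕ := 2 ^ ((Nat.log 2 M + Nat.log 2 n + Nat.log 2 R + d) ^ d) with hBd
  -- `k = 0`: everything is a `Fin 0`-indexed matrix
  rcases Nat.eq_zero_or_pos k with hk0 | hk
  · subst hk0
    refine ⟨0, Nat.zero_le _, 0, 0, fun _ => 1, ?_, fun g => ⟨?_, ?_⟩⟩
    · ext i; exact Fin.elim0 i
    · ext i; exact Fin.elim0 i
    · ext i; exact Fin.elim0 i
  have hM : M ≠ 0 := by omega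
  -- common end: a subgroup fixing a nonzero functional, of index within budget
  have finish : ∀ (L : Subgroup G) (ℓ : (Fin k → ℂ) →ₗ[ℂ] ℂ), ℓ ≠ 0 →
      (∀ l ∈ L, ℓ ∘ₗ Matrix.toLin' (ρ l : Matrix (Fin k) (Fin k) ℂ) = ℓ) → L.index ≤ Bd →
      ∃ m' ≤ Bd,
        ∃ (ι : Matrix (Fin m') (Fin k) ℂ) (p : Matrix (Fin k) (Fin m') ℂ) (τ : G → Perm (Fin m')),
          p * ι = 1 ∧ ∀ g : G,
            (τ g).permMatrix ℂ * ι = ι * (ρ g : Matrix (Fin k) (Fin k) ℂ) ∧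
            p * (τ g).permMatrix ℂ = (ρ g : Matrix (Fin k) (Fin k) ℂ) * p := by
    intro L ℓ hℓ0 hℓL hidx
    obtain ⟨m', ι, p, τ, hm', hpι, hrel⟩ := permRetract_frobenius G L k ρ ℓ hirr hℓ0 hℓL
    exact ⟨m', hm' ▸ hidx, ι, p, τ, hpι, hrel⟩
  -- through `ker ρ`, whenever `(n!)² M` is within budget
  have viaKer : Nat.card (Perm (Fin n) × Perm (Fin n)) * M ≤ Bd →
      ∃ m' ≤ Bd,
        ∃ (ι : Matrix (Fin m') (Fin k) ℂ) (p : Matrix (Fin k) (Fin m') ℂ) (τ : G → Perm (Fin m')),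
          p * ι = 1 ∧ ∀ g : G,
            (τ g).permMatrix ℂ * ι = ι * (ρ g : Matrix (Fin k) (Fin k) ℂ) ∧
            p * (τ g).permMatrix ℂ = (ρ g : Matrix (Fin k) (Fin k) ℂ) * p := by
    intro hbud
    set i₀ : Fin k := ⟨0, hk⟩ with hi₀
    refine finish ρ.ker (LinearMap.proj i₀) ?_ ?_ ?_
    · intro h
      have := LinearMap.congr_fun h (Pi.single i₀ (1 : ℂ))
      simp at this
    · intro l hl
      rw [MonoidHom.mem_ker] at hl
      rw [hl, Units.val_one, Matrix.toLin'_one, LinearMap.comp_id]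
    · exact (index_ker_le_card_mul hk M hM φ ρ hker).trans hbud
  -- regime (A): `n` small against `log₂ k`
  have large : n ≤ a' * (Nat.log 2 k + 1) →
      ∃ m' ≤ Bd,
        ∃ (ι : Matrix (Fin m') (Fin k) ℂ) (p : Matrix (Fin k) (Fin m') ℂ) (τ : G → Perm (Fin m')),
          p * ι = 1 ∧ ∀ g : G,
            (τ g).permMatrix ℂ * ι = ι * (ρ g : Matrix (Fin k) (Fin k) ℂ) ∧
            p * (τ g).permMatrix ℂ = (ρ g : Matrix (Fin k) (Fin k) ℂ) * p := by
    intro hn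
    refine viaKer ?_
    have hn' : n ≤ a' * (Nat.log 2 M + 1) :=
      hn.trans (Nat.mul_le_mul_left _ (Nat.succ_le_succ (Nat.log_mono_right hkM)))
    calc Nat.card (Perm (Fin n) × Perm (Fin n)) * M
        ≤ 2 ^ ((Nat.log 2 M + Nat.log 2 n + (2 * a' + 3)) ^ (2 * a' + 3)) := budget_large a' n M hn'
      _ ≤ Bd := qp_mono (Nat.le_add_right _ _) hd1 (by omega)
  by_cases hA : n ≤ a' * (Nat.log 2 k + 1)
  · exact large hA
  -- regime (B): `n` small against `log₂ R`
  set k₀ : ℕ := Nat.log 2 R + 1 with hk₀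
  by_cases hB : n ≤ 4 * k₀ + 8
  · refine viaKer ?_
    obtain ⟨M', hM'1, hM'2, hM'3⟩ :
        ∃ M' : ℕ, M ≤ M' ∧ R ≤ M' ∧ Nat.log 2 M' ≤ Nat.log 2 M + Nat.log 2 R :=
      ⟨max M R, le_max_left _ _, le_max_right _ _, log_max_le M R⟩
    have hn' : n ≤ 12 * (Nat.log 2 M' + 1) := by
      have : Nat.log 2 R ≤ Nat.log 2 M' := Nat.log_mono_right hM'2
      omega
    have hx : Nat.log 2 M' + Nat.log 2 n ≤ Nat.log 2 M + Nat.log 2 n + Nat.log 2 R := by omega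
    calc Nat.card (Perm (Fin n) × Perm (Fin n)) * M
        ≤ Nat.card (Perm (Fin n) × Perm (Fin n)) * M' := Nat.mul_le_mul_left _ hM'1
      _ ≤ 2 ^ ((Nat.log 2 M' + Nat.log 2 n + (2 * 12 + 3)) ^ (2 * 12 + 3)) := budget_large 12 n M' hn'
      _ ≤ Bd := qp_mono hx hd2 (by norm_num)
  -- regime (C): the group step applies with `k₀ = log₂ R + 1`
  rw [not_le] at hA hB
  have hRpos : 0 < R := Nat.pos_of_ne_zero Subgroup.index_ne_zero_of_finite
  have hRlt : R < 2 ^ k₀ := Nat.lt_pow_succ_log_self one_lt_two R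
  have hidx : φ.range.index < n.choose k₀ :=
    lt_of_lt_of_le hRlt (two_pow_le_choose (by omega))
  have hidx2 : 2 * φ.range.index < (n - k₀).factorial := by
    have h1 : 2 * R < 2 ^ (k₀ + 1) := by rw [pow_succ]; omega
    have h2 : 2 ^ (k₀ + 1) ≤ 2 ^ (n - k₀ - 1) := Nat.pow_le_pow_right (by norm_num) (by omega)
    have h3 : 2 ^ (n - k₀ - 1) ≤ (n - k₀ - 1 + 1).factorial :=
      Literature.Computability.Cryptography.BLPRS2013.two_pow_le_factorial_succ _
    have h4 : n - k₀ - 1 + 1 = n - k₀ := by omega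
    rw [h4] at h3
    exact lt_of_lt_of_le h1 (h2.trans h3)
  obtain ⟨X₁, X₂, hX₁, hX₂, hle⟩ := hGS n φ.range k₀ (by omega) (by omega) (by omega) hidx hidx2
  set A₁ : Subgroup (Perm (Fin n)) := (alternatingGroup {x // x ∉ X₁}).map
      (Equiv.Perm.ofSubtype : Perm {x // x ∉ X₁} →* Perm (Fin n)) with hA₁
  set A₂ : Subgroup (Perm (Fin n)) := (alternatingGroup {x // x ∉ X₂}).map
      (Equiv.Perm.ofSubtype : Perm {x // x ∉ X₂} →* Perm (Fin n)) with hA₂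
  set E : Subgroup G := (A₁.prod A₂).comap φ with hE
  -- the index of `E`
  have hEidx : E.index ≤ 4 * n ^ (2 * k₀) := by
    have h1 : E.index * R = (A₁.prod A₂).index := by
      rw [hE, Subgroup.index_comap, hR, Subgroup.relIndex_mul_index hle]
    have h2 : (A₁.prod A₂).index ≤ 2 * n ^ X₁.card * (2 * n ^ X₂.card) := by
      rw [Subgroup.index_prod]
      exact Nat.mul_le_mul (index_altFixing_le X₁ (by omega)) (index_altFixing_le X₂ (by omega))
    have h3 : n ^ X₁.card * n ^ X₂.card ≤ n ^ (2 * k₀) := by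
      rw [← pow_add]
      exact Nat.pow_le_pow_right (by omega) (by omega)
    calc E.index ≤ E.index * R := Nat.le_mul_of_pos_right _ hRpos
      _ ≤ 2 * n ^ X₁.card * (2 * n ^ X₂.card) := h1 ▸ h2
      _ = 4 * (n ^ X₁.card * n ^ X₂.card) := by ring
      _ ≤ 4 * n ^ (2 * k₀) := Nat.mul_le_mul_left _ h3
  -- the two degrees
  set a : ℕ := Fintype.card {x // x ∉ X₁} with haX
  set b : ℕ := Fintype.card {x // x ∉ X₂} with hbX
  have haeq : a = n - X₁.card := fintype_card_notMem X₁
  have hbeq : b = n - X₂.card := fintype_card_notMem X₂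
  have ha5 : 5 ≤ a := by omega
  have hb5 : 5 ≤ b := by omega
  have hmaxn : max a b ≤ n := by omega
  have hmin : n ≤ 2 * min a b := by omega
  -- `ψ : E ↠ 𝔄_a × 𝔄_b`
  let e₁ : ↥A₁ ≃* ↥(alternatingGroup (Fin a)) :=
    ((alternatingGroup {x // x ∉ X₁}).equivMapOfInjective
        (Equiv.Perm.ofSubtype : Perm {x // x ∉ X₁} →* Perm (Fin n))
        Equiv.Perm.ofSubtype_injective).symm.trans
      (Equiv.altCongrHom (Fintype.equivFin {x // x ∉ X₁}))
  let e₂ : ↥A₂ ≃* ↥(alternatingGroup (Fin b)) :=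
    ((alternatingGroup {x // x ∉ X₂}).equivMapOfInjective
        (Equiv.Perm.ofSubtype : Perm {x // x ∉ X₂} →* Perm (Fin n))
        Equiv.Perm.ofSubtype_injective).symm.trans
      (Equiv.altCongrHom (Fintype.equivFin {x // x ∉ X₂}))
  let e12 : (↥A₁ × ↥A₂) ≃* (↥(alternatingGroup (Fin a)) × ↥(alternatingGroup (Fin b))) :=
    MulEquiv.prodCongr e₁ e₂
  let ψ₀ : E →* ↥(A₁.prod A₂) := (φ.comp E.subtype).codRestrict (A₁.prod A₂) (fun g => g.2)
  let ψ : E →* ↥(alternatingGroup (Fin a)) × ↥(alternatingGroup (Fin b)) :=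
    e12.toMonoidHom.comp ((Subgroup.prodEquiv A₁ A₂).toMonoidHom.comp ψ₀)
  have hψ_def : ∀ g : E, ψ g = e12 ((Subgroup.prodEquiv A₁ A₂) (ψ₀ g)) := fun g => rfl
  have hψ_surj : Function.Surjective ψ := by
    intro x
    set y : ↥(A₁.prod A₂) := (Subgroup.prodEquiv A₁ A₂).symm (e12.symm x) with hy
    obtain ⟨g, hg⟩ : (y : Perm (Fin n) × Perm (Fin n)) ∈ φ.range := hle y.2
    have hgE : g ∈ E := by rw [hE, Subgroup.mem_comap, hg]; exact y.2
    refine ⟨⟨g, hgE⟩, ?_⟩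
    have h0 : ψ₀ ⟨g, hgE⟩ = y := Subtype.ext hg
    rw [hψ_def, h0, hy, MulEquiv.apply_symm_apply, MulEquiv.apply_symm_apply]
  have hψ_ker : ∀ g : E, ψ g = 1 ↔ φ (g : G) = 1 := by
    intro g
    rw [hψ_def, MulEquiv.map_eq_one_iff, MulEquiv.map_eq_one_iff, ← OneMemClass.coe_eq_one]
    exact Iff.rfl
  -- the restricted representation and (H1)₂
  let σ : E →* GL (Fin k) ℂ := ρ.comp E.subtype
  have hσ : ∀ g : E, σ g = ρ (g : G) := fun g => rfl
  have hσker : ∀ g : E, ψ g = 1 → ∃ c : ℂ,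
      (σ g : Matrix (Fin k) (Fin k) ℂ) = c • (1 : Matrix (Fin k) (Fin k) ℂ) := by
    intro g hg
    obtain ⟨c', -, hc'⟩ := hker g ((hψ_ker g).mp hg)
    exact ⟨c', hc'⟩
  rcases ha a b k E ψ σ hψ_surj hσker with hsmall | ⟨θ, hθ⟩
  · refine large ?_
    calc n ≤ 2 * min a b := hmin
      _ ≤ 2 * (a₀ * (Nat.log 2 k + 1)) := Nat.mul_le_mul_left _ hsmall
      _ = (2 * a₀) * (Nat.log 2 k + 1) := by ring
      _ ≤ a' * (Nat.log 2 k + 1) := Nat.mul_le_mul_right _ ha'1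
  -- `θ` has order dividing `M` on `ker ψ`, hence `[E : ker θ] ≤ M` by perfectness
  have hθM : ∀ g : E, ψ g = 1 → θ g ^ M = 1 := by
    intro g hg
    obtain ⟨c', hc'M, hc'⟩ := hker g ((hψ_ker g).mp hg)
    have e : ((θ g : ℂˣ) : ℂ) = c' :=
      (scalar_eq_apply ⟨0, hk⟩ (hθ g hg)).trans (scalar_eq_apply ⟨0, hk⟩ hc').symm
    apply Units.ext
    rw [Units.val_pow_eq_pow_val, e, hc'M, Units.val_one]
  have hθidx : θ.ker.index ≤ M :=
    index_ker_le_of_sup_eq_top ψ θ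
      (ker_sup_ker_eq_top_of_perfect (commutator_alternating_prod_eq_top₂ a b ha5 hb5) ψ hψ_surj θ)
      M hM hθM
  -- the twisted representation `σ' = θ⁻¹ σ`, trivial on `ker ψ`, and its descent to `𝔄_a × 𝔄_b`
  let σ' : E →* GL (Fin k) ℂ :=
    { toFun := fun g => ⟨((θ g)⁻¹ : ℂˣ).val • (σ g : Matrix (Fin k) (Fin k) ℂ),
        (θ g : ℂˣ).val • ((σ g)⁻¹ : GL (Fin k) ℂ).val, by
          rw [Matrix.smul_mul, Matrix.mul_smul, smul_smul, Units.mul_inv, Units.inv_mul, one_smul], by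
          rw [Matrix.smul_mul, Matrix.mul_smul, smul_smul, Units.inv_mul, Units.mul_inv, one_smul]⟩
      map_one' := by
        apply Units.ext
        simp only [map_one, inv_one, Units.val_one, one_smul]
      map_mul' := fun x y => by
        apply Units.ext
        simp only [map_mul, mul_inv, Units.val_mul, Matrix.smul_mul, Matrix.mul_smul, smul_smul]
        rw [mul_comm] }
  have hσ' : ∀ g, (σ' g : Matrix (Fin k) (Fin k) ℂ) =
      ((θ g)⁻¹ : ℂˣ).val • (σ g : Matrix (Fin k) (Fin k) ℂ) := fun g => rfl
  have hσ'ker : ψ.ker ≤ σ'.ker := by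
    intro g hg
    rw [MonoidHom.mem_ker] at hg ⊢
    apply Units.ext
    rw [hσ', hθ g hg, smul_smul, Units.inv_mul, one_smul, Units.val_one]
  obtain ⟨σA, hσA⟩ :
      ∃ σA : (↥(alternatingGroup (Fin a)) × ↥(alternatingGroup (Fin b))) →* GL (Fin k) ℂ,
        ∀ g, σA (ψ g) = σ' g :=
    ⟨ψ.liftOfRightInverse (Function.surjInv hψ_surj) (Function.rightInverse_surjInv hψ_surj)
        ⟨σ', hσ'ker⟩,
      fun g => MonoidHom.liftOfRightInverse_comp_apply ψ (Function.surjInv hψ_surj)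
        (Function.rightInverse_surjInv hψ_surj) ⟨σ', hσ'ker⟩ g⟩
  -- (H2)₂ for the descended representation
  obtain ⟨Y, hYidx, ℓ, hℓ0, hℓY⟩ := hc a b k σA hk
  -- the subgroup `L = (Y.comap ψ ⊓ ker θ) ≤ E ≤ G` fixes `ℓ`
  set L : Subgroup G := (Y.comap ψ ⊓ θ.ker).map E.subtype with hL
  refine finish L ℓ hℓ0 ?_ ?_
  · intro l hl
    obtain ⟨g, hg, rfl⟩ := Subgroup.mem_map.mp hl
    obtain ⟨hgY, hgθ⟩ := Subgroup.mem_inf.mp hg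
    rw [Subgroup.mem_comap] at hgY
    rw [MonoidHom.mem_ker] at hgθ
    have e : (ρ (E.subtype g) : Matrix (Fin k) (Fin k) ℂ) =
        (σA (ψ g) : Matrix (Fin k) (Fin k) ℂ) := by
      rw [hσA, hσ', hgθ, inv_one, Units.val_one, one_smul, hσ, Subgroup.coe_subtype]
    rw [e]
    exact hℓY _ hgY
  · have h1 : L.index = (Y.comap ψ ⊓ θ.ker).index * E.index := Subgroup.index_map_subtype _
    have h2 : (Y.comap ψ ⊓ θ.ker).index ≤ (Y.comap ψ).index * θ.ker.index := Subgroup.index_inf_le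
    have h3 : (Y.comap ψ).index = Y.index := Subgroup.index_comap_of_surjective _ hψ_surj
    -- numerics
    have hn2 : n ≤ 2 ^ (Nat.log 2 n + 1) := (Nat.lt_pow_succ_log_self one_lt_two n).le
    have hnpow : n ^ (2 * k₀) ≤ 2 ^ ((Nat.log 2 n + 1) * (2 * k₀)) := by
      calc n ^ (2 * k₀) ≤ (2 ^ (Nat.log 2 n + 1)) ^ (2 * k₀) := Nat.pow_le_pow_left hn2 _
        _ = 2 ^ ((Nat.log 2 n + 1) * (2 * k₀)) := (pow_mul _ _ _).symm
    have hM2 : M ≤ 2 ^ (Nat.log 2 M + 1) := (Nat.lt_pow_succ_log_self one_lt_two M).le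
    have hY' : Y.index ≤ 2 ^ ((Nat.log 2 M + Nat.log 2 n + c) ^ c) := by
      refine hYidx.trans (Nat.pow_le_pow_right (by norm_num) (Nat.pow_le_pow_left ?_ c))
      have h4 : Nat.log 2 k ≤ Nat.log 2 M := Nat.log_mono_right hkM
      have h5 : Nat.log 2 (max a b) ≤ Nat.log 2 n := Nat.log_mono_right hmaxn
      omega
    have hexp := budget_main c (Nat.log 2 M) (Nat.log 2 n) (Nat.log 2 R)
    calc L.index ≤ (Y.comap ψ).index * θ.ker.index * E.index := by
          rw [h1]; exact Nat.mul_le_mul_right _ h2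
      _ ≤ 2 ^ ((Nat.log 2 M + Nat.log 2 n + c) ^ c) * 2 ^ (Nat.log 2 M + 1) *
            (4 * 2 ^ ((Nat.log 2 n + 1) * (2 * k₀))) := by
          rw [h3]
          exact Nat.mul_le_mul (Nat.mul_le_mul hY' (hθidx.trans hM2))
            (hEidx.trans (Nat.mul_le_mul_left _ hnpow))
      _ = 2 ^ ((Nat.log 2 M + Nat.log 2 n + c) ^ c + (Nat.log 2 M + 1) +
            (2 + (Nat.log 2 n + 1) * (2 * (Nat.log 2 R + 1)))) := by
          rw [hk₀]
          ring
      _ ≤ 2 ^ ((Nat.log 2 M + Nat.log 2 n + Nat.log 2 R + (c + 4)) ^ (c + 4)) :=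
          Nat.pow_le_pow_right (by norm_num) hexp
      _ ≤ Bd := qp_mono le_rfl hd3 (by omega)

end Summit.ValiantsHypothesis.ValiantsHypothesis.Theorems.SymPencilEquivariantSdcNotQP

end
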